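import Literature.AnabelianGeometry.SemiGraphs.TemperedReconstructionCor39CompatChoiceResidue
import Literature.AnabelianGeometry.SemiGraphs.TemperedReconstructionCompatRefutation
import Literature.AnabelianGeometry.SemiGraphs.OneVertexEdgelessHypotheses
import Literature.AnabelianGeometry.SemiGraphs.WitnessIwahoriCoherentCor39
import Literature.AnabelianGeometry.SemiGraphs.WitnessIwahoriCuspChart
import HarnessLib

/-!
# [SemiAnbd] Cor. 3.9: INSTANCE FORMS of the three frozen named facts `Cor39` (F-1710),
# `QuasiGeometricGraphDataCompat` (F-2770), `Cor39Compat` (F-2771) at genuine finite carriers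

Mochizuki, *Semi-graphs of anabelioids*, Publ. RIMS **42** (2006), §3, Definition 3.8 and Corollary 3.9,
manuscript pp. 42–43 [cite: MochizukiSemiAnbd2006, Cor 3.9 pp.42-43]: "Let `G`, `H` be connected, countable,
quasi-coherent, totally elevated, totally estranged, verticially slim graphs of anabelioids. Then applying
'`B^temp(−)`' determines a natural bijective correspondence between locally open morphisms of semi-graphs of
anabelioids `G → H` and quasi-geometric morphisms of temperoids `B^temp(G) → B^temp(H)`."

PROOF-ONLY file (0 definitions, no named fact) of the abc-iut cell, L-F sub-cell [SemiAnbd]+[CombGC], KEY row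
INST59Ib1 (seat abc-iut-f-168 gen 8; FACT-LIST rows F-1710 / F-2770 / F-2771, trunks
`TemperedReconstruction.lean`, `TemperedReconstructionCompat.lean`).  The three named facts are CLOSED
∀-countable-graph statements and their ∀-closures are REFUTED as typed at universe `0` (`not_cor39` — the fold,
abc-iut-f-175; `not_cor39_collapse`; `not_quasiGeometricGraphDataCompat` / `not_cor39Compat` — the escaping
maximal compact subgroup of the infinite θ-ray target, abc-iut-f-175), so no theorem can conclude any of the
three declarations themselves; an INSTANCE FORM of such a row is the BODY of the declaration — its matrix after
the leading `∀ 𝒢 ℋ, Cor39Hypotheses 𝒢 → Cor39Hypotheses ℋ →` is instantiated at a concrete pair and the two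
hypothesis bundles are DISCHARGED — stated verbatim as a closed theorem.  This file records such bodies, BY NAME
from the cell's finite-pair theorems (no new argument about tempered fundamental groups):

1. **F-2770** (`QuasiGeometricGraphDataCompat`, step (R2′)).  The body holds at EVERY pair of finite graphs
   (abc-iut-f-175 `quasiGeometricGraphDataCompatAt_of_finiteGraph`); closed instances at the genuine carriers of
   the Iwahori witness family (abc-iut-w5-d236 / f-175): the estranged loop against itself
   `(𝒢₁(p), 𝒢₁(p))`, the FOLD PAIR `(𝒟₁(p), 𝒢₁(p))` — where the LITERAL body of `Cor39` fails for every pair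
   of charts (`IwahoriWitness.not_cor39_body_at`) — and the single anabelioid `B(P)`, `P = ℤ_p ⋊ (1 + pℤ_p)`
   (the loop's own vertex group), against the loop; all charts, and at `p = 2` with no binder left but the
   body's own.
2. **F-2771** (`Cor39Compat`, chosen-conjugator reading of "induced").  At a finite pair the body is
   EQUIVALENT to (CR) "the chosen conjugator families realise every twist class" (abc-iut-w6-d099
   `cor39CompatAt_iff_chosenRealisesTwists`), a statement about the values of `Classical.choose` that the tree
   cannot settle at any source WITH a branch (e.g. `𝒢₁(p)`: `p` twist classes, `not_inducesOfCompatible`).  At a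
   source with NO branch the conjugator family is unique (`Hom.conjugatorFamily_subsingleton_of_isEmpty`), (CR)
   holds trivially, and the body of `Cor39Compat` HOLDS: `cor39Compat_bodyAt_of_isEmpty_branch_of_finiteGraph`
   (any finite branchless source, any finite target, both as in Cor. 3.9, all charts); closed instances at the
   source `B(P)` (`OneVertex.graph (Iw p)`, abc-iut-L3-t2's one-vertex presentation) against `𝒢₁(p)`.
   HONEST LABEL: the source carrier is DEGENERATE (one vertex, no edge) — exactly the locus where
   the chosen-conjugator residue (CR) is empty; the target carriers are genuine (one resp. two vertices, one
   closed edge, Iwahori-type constituents); the instance is NOT vacuous (`exists_isCompatiblyQuasiGeometric_…`: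
   clause (b)'s premise is inhabited at the explicit source chart, hence so is clause (a)'s).
3. **F-1710** (the literal `Cor39`).  Its body differs from `Cor39Compat`'s only in clause (b)'s premise
   (`IsQuasiGeometric`, the literal Def. 3.8, instead of `IsCompatiblyQuasiGeometric`); when the SOURCE chart
   group is compact its only maximal compact subgroup is `⊤`, the "respectively" clauses are empty and the two
   readings coincide (`isCompatiblyQuasiGeometric_of_isQuasiGeometric_of_compactSpace`).  Hence the LITERAL body
   holds at `(B(P), ℋ)` for the explicit source chart `π₁^temp(B(P)) = P` (abc-iut-L3-t2 `OneVertex.chart`) and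
   every chart of a finite target: `cor39_bodyAt_oneVertex_chart_of_finiteGraph`, closed at `(B(P), 𝒢₁(p))`.  HONEST
   LABEL as in 2: degenerate source, where neither the fold (needs two
   source vertices) nor the escaping maximal compact subgroup (needs an infinite target) can occur.

An instance form of OUR typed statement is not a theorem about [SemiAnbd] Cor. 3.9 in print (which concerns the
finite dual graphs where it is used, and is not claimed false anywhere in the tree); nothing here grades a
reading of Def. 3.8, asserts Thm. 3.7 (iii) at an infinite graph, or takes a side on [IUTchIII] Cor. 3.12;
typed ≠ proved.
-/

open CategoryTheory Topology

namespace Literature.AnabelianGeometry.SemiGraphs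

open Literature.AlgebraicGeometry.Frobenioids (IsSlimGroup)

universe u

/-! ### §0 Def. 3.8: at a compact source the literal and the compatible readings coincide -/

/-- **Def. 3.8 at a COMPACT source group**: in a compact group the only maximal compact subgroup is `⊤`, so the
"respectively" clauses of Def. 3.8 (pairs of DISTINCT maximal compact subgroups of the source) are empty and a
quasi-geometric homomorphism in the literal sense is compatibly quasi-geometric.
[cite: MochizukiSemiAnbd2006, Def 3.8 p.42] -/
theorem isCompatiblyQuasiGeometric_of_isQuasiGeometric_of_compactSpace {G₁ : Type u} [Group G₁]
    [TopologicalSpace G₁] [CompactSpace G₁] {G₂ : Type u} [Group G₂] [TopologicalSpace G₂]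
    (φ : G₁ →ₜ* G₂) (h : IsQuasiGeometric φ) : IsCompatiblyQuasiGeometric φ := by
  have htop : ∀ K : Subgroup G₁, IsMaximalCompactSubgroup K → K = ⊤ := fun K hK =>
    (hK.2 ⊤ (by rw [Subgroup.coe_top]; exact isCompact_univ) le_top).symm
  exact ⟨h, fun K₁ H₁ hK₁ hH₁ hne _ => absurd ((htop K₁ hK₁).trans (htop H₁ hH₁).symm) hne⟩

/-- At a compact source the two readings of Def. 3.8 are EQUIVALENT. [cite: MochizukiSemiAnbd2006, Def 3.8 p.42] -/
theorem isCompatiblyQuasiGeometric_iff_isQuasiGeometric_of_compactSpace {G₁ : Type u} [Group G₁]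
    [TopologicalSpace G₁] [CompactSpace G₁] {G₂ : Type u} [Group G₂] [TopologicalSpace G₂]
    (φ : G₁ →ₜ* G₂) : IsCompatiblyQuasiGeometric φ ↔ IsQuasiGeometric φ :=
  ⟨fun h => h.isQuasiGeometric, isCompatiblyQuasiGeometric_of_isQuasiGeometric_of_compactSpace φ⟩

namespace ProfiniteSemiGraph

variable {𝒢 ℋ : ProfiniteSemiGraph.{u}}

/-! ### §1 Branchless sources: the chosen conjugator family is the only one, so (CR) holds -/

namespace Hom

/-- A morphism whose SOURCE has no branch has exactly one family of conjugating elements (Rmk. 2.4.2: the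
2-cells are indexed by the branches of the source). [cite: MochizukiSemiAnbd2006, Rmk 2.4.2 p.26] -/
theorem conjugatorFamily_subsingleton_of_isEmpty [IsEmpty 𝒢.graph.Branch] (F : Hom 𝒢 ℋ)
    (θ θ' : F.ConjugatorFamily) : θ = θ' := by
  cases θ with
  | mk t ht =>
    cases θ' with
    | mk t' ht' =>
      have h : t = t' := funext fun b => isEmptyElim b
      subst h
      rfl

/-- At a branchless source "induced UP TO TWIST" (`∃ θ`, ruling ξ2) is "induced" for the CHOSEN family (the
frozen `Hom.Induces`). [cite: MochizukiSemiAnbd2006, Prop 3.6(iv) p.39] -/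
theorem induces_of_inducesUpToTwist_of_isEmpty [IsEmpty 𝒢.graph.Branch] (F : Hom 𝒢 ℋ)
    (c𝒢 : TemperedPiChart 𝒢) (cℋ : TemperedPiChart ℋ) (φ : c𝒢.G →ₜ* cℋ.G)
    (h : F.InducesUpToTwist c𝒢 cℋ φ) : F.Induces c𝒢 cℋ φ := by
  obtain ⟨θ, hθ⟩ := h
  rw [F.conjugatorFamily_subsingleton_of_isEmpty θ F.chosenConjugators] at hθ
  exact (F.induces_iff_inducesWith_chosen c𝒢 cℋ φ).mpr hθ

/-- At a branchless source: induced up to twist ⟺ induced (chosen family).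
[cite: MochizukiSemiAnbd2006, Prop 3.6(iv) p.39] -/
theorem inducesUpToTwist_iff_induces_of_isEmpty [IsEmpty 𝒢.graph.Branch] (F : Hom 𝒢 ℋ)
    (c𝒢 : TemperedPiChart 𝒢) (cℋ : TemperedPiChart ℋ) (φ : c𝒢.G →ₜ* cℋ.G) :
    F.InducesUpToTwist c𝒢 cℋ φ ↔ F.Induces c𝒢 cℋ φ :=
  ⟨F.induces_of_inducesUpToTwist_of_isEmpty c𝒢 cℋ φ, F.inducesUpToTwist_of_induces c𝒢 cℋ φ⟩

end Hom

/-- **(CR) at a branchless source**: every homomorphism induced up to twist by a locally open `F` is induced,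
for the chosen family, by a locally open morphism with the same underlying morphism of semi-graphs — namely `F`
itself. [cite: MochizukiSemiAnbd2006, Cor 3.9 p.43] -/
theorem chosenRealisesTwistsAt_of_isEmpty_branch [IsEmpty 𝒢.graph.Branch] (c𝒢 : TemperedPiChart 𝒢)
    (cℋ : TemperedPiChart ℋ) (F : Hom 𝒢 ℋ) (φ : c𝒢.G →ₜ* cℋ.G) (hF : F.IsLocallyOpen)
    (htw : F.InducesUpToTwist c𝒢 cℋ φ) :
    ∃ F' : Hom 𝒢 ℋ, F'.IsLocallyOpen ∧ F'.base = F.base ∧ F'.Induces c𝒢 cℋ φ :=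
  ⟨F, hF, rfl, F.induces_of_inducesUpToTwist_of_isEmpty c𝒢 cℋ φ htw⟩

/-! ### §2 F-2771: the body of `Cor39Compat` at a finite pair with branchless source — unconditional -/

/-- **F-2771, instance form at every finite pair with BRANCHLESS source.**  For FINITE `𝒢`, `ℋ` satisfying the
hypotheses of Cor. 3.9 with `𝒢` branchless, and any charts, the body of the named fact `Cor39Compat` holds: (a) a
homomorphism induced (chosen family) by a locally open morphism is quasi-geometric; (b) every compatibly
quasi-geometric `φ : π₁^temp(𝒢) → π₁^temp(ℋ)` is induced (chosen family) by a locally open morphism, unique on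
vertices and edges — abc-iut-w6-d099's `cor39CompatAt_of_chosenRealisesTwists` with (CR) discharged by
`chosenRealisesTwistsAt_of_isEmpty_branch`. [cite: MochizukiSemiAnbd2006, Cor 3.9 pp.42-43] -/
theorem cor39Compat_bodyAt_of_isEmpty_branch_of_finiteGraph [Finite 𝒢.graph.Vertex] [Finite 𝒢.graph.Edge]
    [Finite ℋ.graph.Vertex] [Finite ℋ.graph.Edge] [IsEmpty 𝒢.graph.Branch] (h𝒢 : Cor39Hypotheses 𝒢)
    (hℋ : Cor39Hypotheses ℋ) (c𝒢 : TemperedPiChart 𝒢) (cℋ : TemperedPiChart ℋ) :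
    (∀ (F : Hom 𝒢 ℋ), F.IsLocallyOpen → ∀ φ : c𝒢.G →ₜ* cℋ.G, F.Induces c𝒢 cℋ φ →
        IsQuasiGeometric φ) ∧
      ∀ φ : c𝒢.G →ₜ* cℋ.G, IsCompatiblyQuasiGeometric φ →
        ∃ F : Hom 𝒢 ℋ, F.IsLocallyOpen ∧ F.Induces c𝒢 cℋ φ ∧
          ∀ F' : Hom 𝒢 ℋ, F'.IsLocallyOpen → F'.Induces c𝒢 cℋ φ →
            F'.base.vertexMap = F.base.vertexMap ∧ F'.base.edgeMap = F.base.edgeMap :=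
  cor39CompatAt_of_chosenRealisesTwists h𝒢 hℋ c𝒢 cℋ
    fun F φ hF htw => chosenRealisesTwistsAt_of_isEmpty_branch c𝒢 cℋ F φ hF htw

/-! ### §3 The single anabelioid `B(P)` as source: all three bodies -/

section OneVertexSource

variable {P : Type u} [Group P] [TopologicalSpace P] [IsTopologicalGroup P] [CompactSpace P]
  [TotallyDisconnectedSpace P]

/-- The one-vertex edgeless graph of anabelioids `B(P)` over a slim profinite `P` with a level family satisfies
the hypotheses of Cor. 3.9 (it is, vacuously, a totally estranged graph; abc-iut-L3-t2's `OneVertex` bundle).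
[cite: MochizukiSemiAnbd2006, Cor 3.9 p.42] -/
theorem OneVertex.cor39Hypotheses (L : LevelFamily P) (hslim : IsSlimGroup P) :
    Cor39Hypotheses (OneVertex.graph P) :=
  ⟨OneVertex.prop36Hypotheses L hslim, OneVertex.isTotallyEstranged, ⟨fun b => nomatch b⟩⟩

/-- **F-2771 at `(B(P), ℋ)`, `ℋ` FINITE as in Cor. 3.9, all charts — unconditional**: the body of `Cor39Compat`.
HONEST LABEL: degenerate (branchless) source. [cite: MochizukiSemiAnbd2006, Cor 3.9 pp.42-43] -/
theorem cor39Compat_bodyAt_oneVertex_of_finiteGraph (L : LevelFamily P) (hslim : IsSlimGroup P)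
    [Finite ℋ.graph.Vertex] [Finite ℋ.graph.Edge] (hℋ : Cor39Hypotheses ℋ)
    (c : TemperedPiChart (OneVertex.graph P)) (cℋ : TemperedPiChart ℋ) :
    (∀ (F : Hom (OneVertex.graph P) ℋ), F.IsLocallyOpen → ∀ φ : c.G →ₜ* cℋ.G, F.Induces c cℋ φ →
        IsQuasiGeometric φ) ∧
      ∀ φ : c.G →ₜ* cℋ.G, IsCompatiblyQuasiGeometric φ →
        ∃ F : Hom (OneVertex.graph P) ℋ, F.IsLocallyOpen ∧ F.Induces c cℋ φ ∧
          ∀ F' : Hom (OneVertex.graph P) ℋ, F'.IsLocallyOpen → F'.Induces c cℋ φ →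
            F'.base.vertexMap = F.base.vertexMap ∧ F'.base.edgeMap = F.base.edgeMap :=
  haveI : Finite (OneVertex.graph P).graph.Vertex := inferInstanceAs (Finite PUnit)
  haveI : Finite (OneVertex.graph P).graph.Edge := inferInstanceAs (Finite PEmpty)
  haveI : IsEmpty (OneVertex.graph P).graph.Branch := inferInstanceAs (IsEmpty PEmpty)
  cor39Compat_bodyAt_of_isEmpty_branch_of_finiteGraph (OneVertex.cor39Hypotheses L hslim) hℋ c cℋ

/-- **F-2770 at `(B(P), ℋ)`, `ℋ` FINITE as in Cor. 3.9, all charts — unconditional**: the body of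
`QuasiGeometricGraphDataCompat` (step (R2′)), abc-iut-f-175's `quasiGeometricGraphDataCompatAt_of_finiteGraph`.
[cite: MochizukiSemiAnbd2006, Cor 3.9 pp.42-43] -/
theorem quasiGeometricGraphDataCompat_bodyAt_oneVertex_of_finiteGraph (L : LevelFamily P)
    (hslim : IsSlimGroup P) [Finite ℋ.graph.Vertex] [Finite ℋ.graph.Edge] (hℋ : Cor39Hypotheses ℋ)
    (c : TemperedPiChart (OneVertex.graph P)) (cℋ : TemperedPiChart ℋ) (φ : c.G →ₜ* cℋ.G)
    (hφ : IsCompatiblyQuasiGeometric φ) :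
    ∃ F : Hom (OneVertex.graph P) ℋ, F.IsLocallyOpen ∧ F.CompatV c cℋ φ ∧ F.CompatE c cℋ φ :=
  haveI : Finite (OneVertex.graph P).graph.Vertex := inferInstanceAs (Finite PUnit)
  haveI : Finite (OneVertex.graph P).graph.Edge := inferInstanceAs (Finite PEmpty)
  quasiGeometricGraphDataCompatAt_of_finiteGraph (OneVertex.cor39Hypotheses L hslim) hℋ c cℋ φ hφ

/-- **F-1710 at `(B(P), ℋ)` for the EXPLICIT source chart `π₁^temp(B(P)) = P`, `ℋ` FINITE as in Cor. 3.9, every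
target chart — unconditional**: the body of the LITERAL `Cor39`.  Clause (b)'s literal premise is upgraded to the
compatible one by `isCompatiblyQuasiGeometric_of_isQuasiGeometric_of_compactSpace` (`P` compact), then F-2771's
body at the pair applies.  HONEST LABEL: degenerate (branchless) source; the fold of `not_cor39` needs two source
vertices. [cite: MochizukiSemiAnbd2006, Cor 3.9 pp.42-43] -/
theorem cor39_bodyAt_oneVertex_chart_of_finiteGraph [SecondCountableTopology P] (L : LevelFamily P)
    (hslim : IsSlimGroup P) [Finite ℋ.graph.Vertex] [Finite ℋ.graph.Edge] (hℋ : Cor39Hypotheses ℋ)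
    (cℋ : TemperedPiChart ℋ) :
    (∀ (F : Hom (OneVertex.graph P) ℋ), F.IsLocallyOpen →
        ∀ φ : (OneVertex.chart L).G →ₜ* cℋ.G, F.Induces (OneVertex.chart L) cℋ φ → IsQuasiGeometric φ) ∧
      ∀ φ : (OneVertex.chart L).G →ₜ* cℋ.G, IsQuasiGeometric φ →
        ∃ F : Hom (OneVertex.graph P) ℋ, F.IsLocallyOpen ∧ F.Induces (OneVertex.chart L) cℋ φ ∧
          ∀ F' : Hom (OneVertex.graph P) ℋ, F'.IsLocallyOpen → F'.Induces (OneVertex.chart L) cℋ φ →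
            F'.base.vertexMap = F.base.vertexMap ∧ F'.base.edgeMap = F.base.edgeMap := by
  obtain ⟨ha, hb⟩ := cor39Compat_bodyAt_oneVertex_of_finiteGraph L hslim hℋ (OneVertex.chart L) cℋ
  haveI : CompactSpace (OneVertex.chart L).G := ‹CompactSpace P›
  exact ⟨ha, fun φ hφ => hb φ (isCompatiblyQuasiGeometric_of_isQuasiGeometric_of_compactSpace φ hφ)⟩

/-- **Non-vacuity of clause (b) at the explicit source chart**: for every chart of a FINITE target `ℋ` as in
Thm. 3.7 onto whose vertex group `Π_w` the group `P` surjects continuously (`e : P ↠ Π_w`), some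
`φ : P → π₁^temp(ℋ)` IS compatibly quasi-geometric — a verticial homomorphism at `w` (Thm. 3.7 (i)) precomposed
with `e`: its range is the verticial = maximal compact subgroup (Thm. 3.7 (iv) at the finite `ℋ`), onto which the
unique maximal compact subgroup `⊤` of `P` maps. [cite: MochizukiSemiAnbd2006, Thm 3.7(iv) p.41] -/
theorem exists_isCompatiblyQuasiGeometric_oneVertex_chart [SecondCountableTopology P] (L : LevelFamily P)
    [Finite ℋ.graph.Vertex] [Finite ℋ.graph.Edge] (hℋ : ℋ.Thm37Hypotheses) (cℋ : TemperedPiChart ℋ)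
    (w : ℋ.graph.Vertex) (e : P →ₜ* ℋ.Gv w) (he : Function.Surjective e) :
    ∃ φ : (OneVertex.chart L).G →ₜ* cℋ.G, IsCompatiblyQuasiGeometric φ := by
  obtain ⟨⟨_, ψ, hψ, rfl⟩, -⟩ := verticialInjective_holds ℋ hℋ cℋ w
  have hmax : IsMaximalCompactSubgroup ψ.toMonoidHom.range :=
    ((maximalCompactIffVerticialAt_of_finiteGraph hℋ cℋ).1 _).mpr ⟨w, ψ, hψ, rfl⟩
  have hrange : (ψ.comp e).toMonoidHom.range = ψ.toMonoidHom.range := by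
    change (ψ.toMonoidHom.comp e.toMonoidHom).range = _
    rw [MonoidHom.range_comp, MonoidHom.range_eq_top.mpr he, ← MonoidHom.range_eq_map]
  have htop : ∀ K : Subgroup P, IsMaximalCompactSubgroup K → K = ⊤ := fun K hK =>
    (hK.2 ⊤ (by rw [Subgroup.coe_top]; exact isCompact_univ) le_top).symm
  have hq : IsQuasiGeometric (ψ.comp e) := by
    refine ⟨fun K₁ hK₁ => ⟨ψ.toMonoidHom.range, hmax, ?_, ?_⟩, fun K₁ H₁ hK₁ hH₁ hne _ =>
      absurd ((htop K₁ hK₁).trans (htop H₁ hH₁).symm) hne⟩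
    · rw [htop K₁ hK₁, ← MonoidHom.range_eq_map, hrange]
    · rw [htop K₁ hK₁, ← MonoidHom.range_eq_map, hrange]
      have : (Subtype.val : ψ.toMonoidHom.range → cℋ.G) ⁻¹' (ψ.toMonoidHom.range : Set cℋ.G) = Set.univ :=
        Set.eq_univ_of_forall fun x => x.2
      rw [this]
      exact isOpen_univ
  haveI : CompactSpace (OneVertex.chart L).G := ‹CompactSpace P›
  exact ⟨ψ.comp e, isCompatiblyQuasiGeometric_of_isQuasiGeometric_of_compactSpace _ hq⟩

end OneVertexSource

end ProfiniteSemiGraph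

/-! ### §4 Closed instances at the Iwahori witness family (`P = ℤ_p ⋊ (1 + pℤ_p)`, the loop `𝒢₁(p)`, its double `𝒟₁(p)`) -/

namespace IwahoriWitness

open ProfiniteSemiGraph

section IwahoriFamily

variable (p : ℕ) [Fact p.Prime]

/-- **F-2770 at `(𝒢₁(p), 𝒢₁(p))`** — the estranged loop against itself (one vertex `ℤ_p ⋊ (1+pℤ_p)`, one closed
edge `1 + pℤ_p`, torus / twisted-complement branches), all charts: the body of `QuasiGeometricGraphDataCompat`.
[cite: MochizukiSemiAnbd2006, Cor 3.9 pp.42-43] -/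
theorem quasiGeometricGraphDataCompat_bodyAt_loopGraph :
    ∀ (c𝒢 cℋ : TemperedPiChart (loopGraph p)) (φ : c𝒢.G →ₜ* cℋ.G), IsCompatiblyQuasiGeometric φ →
      ∃ F : Hom (loopGraph p) (loopGraph p), F.IsLocallyOpen ∧ F.CompatV c𝒢 cℋ φ ∧ F.CompatE c𝒢 cℋ φ := by
  haveI : Finite (loopGraph p).graph.Vertex := (loopGraph_isFinite p).finite_vertex
  haveI : Finite (loopGraph p).graph.Edge := (loopGraph_isFinite p).finite_edge
  exact fun c𝒢 cℋ φ hφ => quasiGeometricGraphDataCompatAt_of_finiteGraph (loopGraph_cor39Hypotheses p)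
    (loopGraph_cor39Hypotheses p) c𝒢 cℋ φ hφ

/-- **F-2770 at the FOLD PAIR `(𝒟₁(p), 𝒢₁(p))`** (the double of the loop along its torus branch against the
loop), all charts: the body of `QuasiGeometricGraphDataCompat` HOLDS here — whereas the body of the literal
`Cor39` fails at this very pair for every pair of charts (`IwahoriWitness.not_cor39_body_at`: the fold is
quasi-geometric literally, not compatibly). [cite: MochizukiSemiAnbd2006, Cor 3.9 pp.42-43] -/
theorem quasiGeometricGraphDataCompat_bodyAt_doubleLoop_loopGraph :
    ∀ (c𝒢 : TemperedPiChart (doubleLoop p)) (cℋ : TemperedPiChart (loopGraph p)) (φ : c𝒢.G →ₜ* cℋ.G),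
      IsCompatiblyQuasiGeometric φ →
      ∃ F : Hom (doubleLoop p) (loopGraph p), F.IsLocallyOpen ∧ F.CompatV c𝒢 cℋ φ ∧ F.CompatE c𝒢 cℋ φ := by
  haveI : Finite (loopGraph p).graph.Vertex := (loopGraph_isFinite p).finite_vertex
  haveI : Finite (loopGraph p).graph.Edge := (loopGraph_isFinite p).finite_edge
  haveI : Finite (doubleLoop p).graph.Vertex := (doubleLoop_isFinite p).finite_vertex
  haveI : Finite (doubleLoop p).graph.Edge := (doubleLoop_isFinite p).finite_edge
  exact fun c𝒢 cℋ φ hφ => quasiGeometricGraphDataCompatAt_of_finiteGraph (doubleLoop_cor39Hypotheses p)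
    (loopGraph_cor39Hypotheses p) c𝒢 cℋ φ hφ

/-- **F-2771 at `(B(P), 𝒢₁(p))`, `P = ℤ_p ⋊ (1 + pℤ_p)`** — the single anabelioid on the loop's own vertex group
against the loop, all charts: the body of `Cor39Compat`.  HONEST LABEL: degenerate (branchless) source.
[cite: MochizukiSemiAnbd2006, Cor 3.9 pp.42-43] -/
theorem cor39Compat_bodyAt_oneVertexIw_loopGraph :
    ∀ (c𝒢 : TemperedPiChart (OneVertex.graph (Iw p))) (cℋ : TemperedPiChart (loopGraph p)),
      (∀ (F : Hom (OneVertex.graph (Iw p)) (loopGraph p)), F.IsLocallyOpen →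
          ∀ φ : c𝒢.G →ₜ* cℋ.G, F.Induces c𝒢 cℋ φ → IsQuasiGeometric φ) ∧
        ∀ φ : c𝒢.G →ₜ* cℋ.G, IsCompatiblyQuasiGeometric φ →
          ∃ F : Hom (OneVertex.graph (Iw p)) (loopGraph p), F.IsLocallyOpen ∧ F.Induces c𝒢 cℋ φ ∧
            ∀ F' : Hom (OneVertex.graph (Iw p)) (loopGraph p), F'.IsLocallyOpen → F'.Induces c𝒢 cℋ φ →
              F'.base.vertexMap = F.base.vertexMap ∧ F'.base.edgeMap = F.base.edgeMap := by
  haveI : Finite (loopGraph p).graph.Vertex := (loopGraph_isFinite p).finite_vertex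
  haveI : Finite (loopGraph p).graph.Edge := (loopGraph_isFinite p).finite_edge
  exact fun c𝒢 cℋ => cor39Compat_bodyAt_oneVertex_of_finiteGraph (LevelFamily.iw p) (isSlimGroup_Iw p)
    (loopGraph_cor39Hypotheses p) c𝒢 cℋ

/-- **F-1710 at `(B(P), 𝒢₁(p))` for the explicit source chart `π₁^temp(B(P)) = P`** (any level family `L` of
`P`, every chart of the loop): the body of the LITERAL `Cor39`.  HONEST LABEL: degenerate (branchless) source.
[cite: MochizukiSemiAnbd2006, Cor 3.9 pp.42-43] -/
theorem cor39_bodyAt_oneVertexIw_chart_loopGraph :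
    haveI := secondCountableTopology_iw p
    ∀ (L : LevelFamily (Iw p)) (cℋ : TemperedPiChart (loopGraph p)),
      (∀ (F : Hom (OneVertex.graph (Iw p)) (loopGraph p)), F.IsLocallyOpen →
          ∀ φ : (OneVertex.chart L).G →ₜ* cℋ.G, F.Induces (OneVertex.chart L) cℋ φ → IsQuasiGeometric φ) ∧
        ∀ φ : (OneVertex.chart L).G →ₜ* cℋ.G, IsQuasiGeometric φ →
          ∃ F : Hom (OneVertex.graph (Iw p)) (loopGraph p), F.IsLocallyOpen ∧
            F.Induces (OneVertex.chart L) cℋ φ ∧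
            ∀ F' : Hom (OneVertex.graph (Iw p)) (loopGraph p), F'.IsLocallyOpen →
              F'.Induces (OneVertex.chart L) cℋ φ →
              F'.base.vertexMap = F.base.vertexMap ∧ F'.base.edgeMap = F.base.edgeMap := by
  haveI := secondCountableTopology_iw p
  haveI : Finite (loopGraph p).graph.Vertex := (loopGraph_isFinite p).finite_vertex
  haveI : Finite (loopGraph p).graph.Edge := (loopGraph_isFinite p).finite_edge
  exact fun L cℋ => cor39_bodyAt_oneVertex_chart_of_finiteGraph L (isSlimGroup_Iw p)
    (loopGraph_cor39Hypotheses p) cℋ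

/-- **Non-vacuity at `(B(P), 𝒢₁(p))`**: for every level family `L` and every chart of the loop, clause (b)'s
premise is inhabited — some `φ : P → π₁^temp(𝒢₁(p))` is compatibly (hence literally) quasi-geometric (a verticial
homomorphism at the loop's vertex, whose group IS `P`, through `id`); by clause (b) it is induced by a locally open morphism,
so clause (a)'s premise is inhabited too. [cite: MochizukiSemiAnbd2006, Thm 3.7(iv) p.41] -/
theorem exists_isCompatiblyQuasiGeometric_oneVertexIw_chart_loopGraph :
    haveI := secondCountableTopology_iw p
    ∀ (L : LevelFamily (Iw p)) (cℋ : TemperedPiChart (loopGraph p)),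
      ∃ φ : (OneVertex.chart L).G →ₜ* cℋ.G, IsCompatiblyQuasiGeometric φ ∧
        ∃ F : Hom (OneVertex.graph (Iw p)) (loopGraph p), F.IsLocallyOpen ∧
          F.Induces (OneVertex.chart L) cℋ φ := by
  haveI := secondCountableTopology_iw p
  haveI : Finite (loopGraph p).graph.Vertex := (loopGraph_isFinite p).finite_vertex
  haveI : Finite (loopGraph p).graph.Edge := (loopGraph_isFinite p).finite_edge
  intro L cℋ
  obtain ⟨φ, hφ⟩ := exists_isCompatiblyQuasiGeometric_oneVertex_chart L (loopGraph_thm37Hypotheses p) cℋ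
    PUnit.unit (ContinuousMonoidHom.id (Iw p)) Function.surjective_id
  obtain ⟨F, hF, hind, -⟩ := (cor39Compat_bodyAt_oneVertex_of_finiteGraph L (isSlimGroup_Iw p)
    (loopGraph_cor39Hypotheses p) (OneVertex.chart L) cℋ).2 φ hφ
  exact ⟨φ, hφ, F, hF, hind⟩

end IwahoriFamily

/-! ### §5 The same instances with NO binder left but the body's own (`p = 2`) -/

section Closed

/-- **F-2770, closed instance**: the body of `QuasiGeometricGraphDataCompat` at `(𝒢₁(2), 𝒢₁(2))`.
[cite: MochizukiSemiAnbd2006, Cor 3.9 pp.42-43] -/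
theorem quasiGeometricGraphDataCompat_bodyAt_loopGraph_two :
    ∀ (c𝒢 cℋ : TemperedPiChart (loopGraph 2)) (φ : c𝒢.G →ₜ* cℋ.G), IsCompatiblyQuasiGeometric φ →
      ∃ F : Hom (loopGraph 2) (loopGraph 2), F.IsLocallyOpen ∧ F.CompatV c𝒢 cℋ φ ∧ F.CompatE c𝒢 cℋ φ :=
  quasiGeometricGraphDataCompat_bodyAt_loopGraph 2

/-- **F-2771, closed instance**: the body of `Cor39Compat` at `(B(ℤ_2 ⋊ (1 + 2ℤ_2)), 𝒢₁(2))`.  HONEST LABEL: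
degenerate (branchless) source. [cite: MochizukiSemiAnbd2006, Cor 3.9 pp.42-43] -/
theorem cor39Compat_bodyAt_oneVertexIw_loopGraph_two :
    ∀ (c𝒢 : TemperedPiChart (OneVertex.graph (Iw 2))) (cℋ : TemperedPiChart (loopGraph 2)),
      (∀ (F : Hom (OneVertex.graph (Iw 2)) (loopGraph 2)), F.IsLocallyOpen →
          ∀ φ : c𝒢.G →ₜ* cℋ.G, F.Induces c𝒢 cℋ φ → IsQuasiGeometric φ) ∧
        ∀ φ : c𝒢.G →ₜ* cℋ.G, IsCompatiblyQuasiGeometric φ →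
          ∃ F : Hom (OneVertex.graph (Iw 2)) (loopGraph 2), F.IsLocallyOpen ∧ F.Induces c𝒢 cℋ φ ∧
            ∀ F' : Hom (OneVertex.graph (Iw 2)) (loopGraph 2), F'.IsLocallyOpen → F'.Induces c𝒢 cℋ φ →
              F'.base.vertexMap = F.base.vertexMap ∧ F'.base.edgeMap = F.base.edgeMap :=
  cor39Compat_bodyAt_oneVertexIw_loopGraph 2

/-- **F-1710, closed instance**: the body of the LITERAL `Cor39` at `(B(ℤ_2 ⋊ (1 + 2ℤ_2)), 𝒢₁(2))` for the
explicit source chart (every level family, every target chart).  HONEST LABEL: degenerate (branchless) source.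
[cite: MochizukiSemiAnbd2006, Cor 3.9 pp.42-43] -/
theorem cor39_bodyAt_oneVertexIw_chart_loopGraph_two :
    haveI := secondCountableTopology_iw 2
    ∀ (L : LevelFamily (Iw 2)) (cℋ : TemperedPiChart (loopGraph 2)),
      (∀ (F : Hom (OneVertex.graph (Iw 2)) (loopGraph 2)), F.IsLocallyOpen →
          ∀ φ : (OneVertex.chart L).G →ₜ* cℋ.G, F.Induces (OneVertex.chart L) cℋ φ → IsQuasiGeometric φ) ∧
        ∀ φ : (OneVertex.chart L).G →ₜ* cℋ.G, IsQuasiGeometric φ →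
          ∃ F : Hom (OneVertex.graph (Iw 2)) (loopGraph 2), F.IsLocallyOpen ∧
            F.Induces (OneVertex.chart L) cℋ φ ∧
            ∀ F' : Hom (OneVertex.graph (Iw 2)) (loopGraph 2), F'.IsLocallyOpen →
              F'.Induces (OneVertex.chart L) cℋ φ →
              F'.base.vertexMap = F.base.vertexMap ∧ F'.base.edgeMap = F.base.edgeMap :=
  cor39_bodyAt_oneVertexIw_chart_loopGraph 2

/-- The binder types of the closed instances are inhabited: a level family of `ℤ_2 ⋊ (1 + 2ℤ_2)` and charts of
`B(P)`, `𝒢₁(2)`, `𝒟₁(2)` exist. [cite: MochizukiSemiAnbd2006, Prop 3.6(ii) p.38] -/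
theorem nonempty_binders_two :
    Nonempty (LevelFamily (Iw 2)) ∧ Nonempty (TemperedPiChart (OneVertex.graph (Iw 2))) ∧
      Nonempty (TemperedPiChart (loopGraph 2)) ∧ Nonempty (TemperedPiChart (doubleLoop 2)) := by
  haveI := secondCountableTopology_iw 2
  exact ⟨⟨LevelFamily.iw 2⟩, ⟨OneVertex.chart (LevelFamily.iw 2)⟩,
    ExistsTemperedPiChart_holds _ (loopGraph_prop36Hypotheses 2),
    ExistsTemperedPiChart_holds _ (doubleLoop_prop36Hypotheses 2)⟩

end Closed

end IwahoriWitness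

end Literature.AnabelianGeometry.SemiGraphs
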